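import Summits.ValiantsHypothesis.ValiantsHypothesis.Theorems.NewtonUnitEquationsTwoProductsRankOneThreeGenLawFree
import HarnessLib

/-!
# Route NewtonUnitEquations — crux `TwoProducts` (stmt-ValiantsHypothesis-5906), line `relation_ladder`, rung R7b (rank one on THREE
# letters, ALL coefficient patterns `p•α = q•β + r•γ`) + rung R7c (TWO letters with torsion): the DILATED FREE LIFT — part 2/7 — `kap`, the multinomial regrouping, fibre sums, the slice functions and THE COEFFICIENT THEOREM (T3 end, T4)

(T3, end) `kap`, `multinomial_Lof_eq`, `coeff_phiT_frM`; (T4) `ind/lam/restProd/gd/mainConst/mainTerm/corr/Fsl`, per-term evaluation, `coeff_free_logTrunc`.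

val-idea-8 g3 (ideator; lens decomp), 2026-08-28.  THE GENERAL THREE-LETTER RANK-ONE LAW `p•α = q•β + r•γ` (all `p, q ≥ 1`, `r ≥ 0`):
lift `α ↦ Y_b^q Y_c^r, β ↦ Y_b^p, γ ↦ Y_c^p` over the `p`-DILATED plane (`enumP : b ↦ β, c ↦ γ, i ↦ p•enum i`), fibres `k` with divisibility
guards `p ∣ x_b − qk`, `p ∣ x_c − rk`, letter count `B_k = k + (x_b−qk)/p + (x_c−rk)/p`, DOUBLE SLICING `(b₁, b₂) = (x_b, x_c)`, the coefficient
theorem with `Pfac · C(R + B_k − 1, B_k) · κ_k`, finite SHIFT RANK and val-lit-p3's `ShiftRank.pencilCount` BY NAME; large or absent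
coefficients/letters are permutation type (R3♯).  Instances: R6b (1;1,1), R6c (2;1,1), R7a (p = 1, `visible_bound_free`), R6d = val-lit-p3's
homogeneous shape (p = q + r, `visible_bound_hom`), and rung R7c = rank one on TWO letters with torsion `p•α = q•β` (`r = 0`, idle third letter).

PORT NOTE (val-lit-p3 g15, prover seat, helper mode `--supports stmt-ValiantsHypothesis-5906 --as helper`, no stub credit claimed; the author's
request val-width INBOX 12:15Z/12:19Z + desk RULING #279 (c)): part 2/7 of a VERBATIM Theorems-side port of val-idea-8 g3's sorry-free module
`Cruxes/TwoProducts/Lines/relation_ladder_R7b.lean` REV 2 (tree sha256 f9e10d1fedcbd387…; 1 890 lines; `lean check` rc 0, 0 sorries,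
0 warnings, axioms standard).  ALL mathematics and ALL proofs are val-idea-8 g3's.  Port changes only: (i) file split + import chain;
(ii) declarations re-declared verbatim from LANDED ports are referenced BY NAME instead — `R6b.sum_sgn`, `R6b.HSD` (+ six closure
lemmas), `R6b.hsd_binChar` (R6b port); `tab`, `sgn`, `toolBound_mono` (R6 port, parent namespace); `R7a.SIdx`, `R7a.card_SIdx`,
`R7a.msetT_apply_le`, `R7a.permType_of_rankOne_largeCoeff`, `R7a.permType_of_rankOne_absent` (R7a port); `rankOne_symm` =
`R6c.rankOneCoincidences_symm` (R6c); `wt_nsmul'` = `FormalLogLinearisation.wt_nsmul`; (iii) section variables α-renamed `I ↦ Ig`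
(QIdx datum), `D ↦ Dg` (RelData datum) — forced by the gate's textual statement index (`dedup.landed`), since the R6b / R7a ports own
same-text lemmas over `ThreeIdx` / `QIdx`; (iv) docstrings on API lemmas; (v) in part 7/7 the parameter-free `def RankOneThreeGenLaw : Prop`
and `def RankOneTwoLaw : Prop` are NOT declared (relocation rule) — the laws are stated by their LITERAL bodies as `rankOneThreeGenLaw_proof`
and `rankOneTwoLaw_proof`; `visible_bound_free` / `visible_bound_hom` keep their names and texts.  Namespace = the author's
(`…PermutationType.R7b`).  Nothing here closes the line's residual, the crux `TwoProducts` (5906) or `VP ≠ VNP`; no summit statement is proved.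

Honest scope (the author's): rank one on FOUR letters with general coefficients, relations on ≥ 5 letters, one-sided `p•α = Σ qᵢ βᵢ` (R8, memo
only) and coincidence rank ≥ 2 are NOT covered here.  Nothing here moves VP ≠ VNP; `TwoProducts` (5906) stays OPEN. [folklore]
-/

noncomputable section

-- Sub = Summit single-conjunct layout: the duplicated namespace component is mandated by the tree.
set_option linter.dupNamespace false
set_option linter.unusedSimpArgs false
set_option linter.deprecated false
set_option linter.unusedSectionVars false
set_option linter.unusedVariables false
set_option linter.unnecessarySeqFocus false

namespace Summit.ValiantsHypothesis.ValiantsHypothesis.Theorems.NewtonUnitEquations.TwoProducts.PermutationType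
namespace R7b
open scoped BigOperators
open MvPolynomial

variable {σ : Type*} [Fintype σ] [DecidableEq σ]

variable (Ig : QIdx σ)

/-- The fibre constant `κ_k = B_k! / (k! ((b₁ − q k)/p)! ((b₂ − r k)/p)!)`. [folklore] -/
def kap (b₁ b₂ k : ℕ) : ℂ :=
  (((Bk Ig b₁ b₂ k).factorial : ℕ) : ℂ) /
    (((k.factorial * ((b₁ - Ig.q * k) / Ig.p).factorial * ((b₂ - Ig.r * k) / Ig.p).factorial : ℕ)) : ℂ)

/-- (F5) **Multinomial regrouping along the fibre** (varying letter count, double slicing):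
`multinomial(L_k) = Pfac(x) · C(R + B_k − 1, B_k) · κ_k · deg(L_k)` for `R = deg x̂ ≥ 1`. [folklore] -/
theorem multinomial_Lof_eq (x : σ →₀ ℕ) (k : ℕ) (hk : k ∈ KR Ig x) (h1 : 1 ≤ deg (xhat Ig x)) :
    ((Lof Ig x k).multinomial : ℂ) =
      Pfac Ig x * (((deg (xhat Ig x) + Bk Ig (x Ig.b) (x Ig.c) k - 1).choose (Bk Ig (x Ig.b) (x Ig.c) k) : ℕ) : ℂ) *
        kap Ig (x Ig.b) (x Ig.c) k * ((deg (Lof Ig x k) : ℕ) : ℂ) := by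
  have hk' := (mem_KR Ig x k).1 hk
  have hdeg := deg_Lof_eq Ig x k hk
  set Dg := deg (xhat Ig x) with hD
  set B := Bk Ig (x Ig.b) (x Ig.c) k with hB
  set n := deg (Lof Ig x k) with hn
  have sL := Nat.multinomial_spec (Finset.univ : Finset σ) (Lof Ig x k)
  rw [← multinomial_univ, ← deg_eq_sum] at sL
  rw [prod_three_split Ig, Lof_a, Lof_b, Lof_c] at sL
  have hr : ∏ j ∈ rest Ig, ((Lof Ig x k) j).factorial = ∏ j ∈ rest Ig, (x j).factorial := by
    refine Finset.prod_congr rfl fun j hj => ?_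
    rw [mem_rest] at hj
    rw [Lof_other Ig x k j hj.1 hj.2.1 hj.2.2]
  rw [hr, ← hn] at sL
  -- factorial identities
  have h2 : (Dg + B - 1).choose B * B.factorial * (Dg - 1).factorial = (Dg + B - 1).factorial := by
    have := Nat.choose_mul_factorial_mul_factorial (n := Dg + B - 1) (k := B) (by omega)
    rwa [show Dg + B - 1 - B = Dg - 1 by omega] at this
  have h3 : n.factorial = n * (Dg + B - 1).factorial := by
    rw [show n = (Dg + B - 1) + 1 by omega, Nat.factorial_succ]
  set P : ℂ := ∏ j ∈ rest Ig, ((((x j).factorial : ℕ)) : ℂ) with hP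
  set Kd : ℂ := ((k.factorial : ℕ) : ℂ) * ((((x Ig.b - Ig.q * k) / Ig.p).factorial : ℕ) : ℂ) *
    ((((x Ig.c - Ig.r * k) / Ig.p).factorial : ℕ) : ℂ) with hKd
  have hPne : P ≠ 0 := Finset.prod_ne_zero_iff.mpr fun j _ => Nat.cast_ne_zero.mpr (Nat.factorial_ne_zero _)
  have hKdne : Kd ≠ 0 :=
    mul_ne_zero (mul_ne_zero (Nat.cast_ne_zero.mpr (Nat.factorial_ne_zero _)) (Nat.cast_ne_zero.mpr (Nat.factorial_ne_zero _)))
      (Nat.cast_ne_zero.mpr (Nat.factorial_ne_zero _))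
  have key : ((Lof Ig x k).multinomial : ℂ) * (P * Kd) =
      (n : ℂ) * ((((Dg + B - 1).choose B : ℕ) : ℂ) * ((B.factorial : ℕ) : ℂ) * (((Dg - 1).factorial : ℕ) : ℂ)) := by
    have e : ((((∏ j ∈ rest Ig, (x j).factorial) *
        (k.factorial * (((x Ig.b - Ig.q * k) / Ig.p).factorial * ((x Ig.c - Ig.r * k) / Ig.p).factorial)) *
        (Lof Ig x k).multinomial : ℕ)) : ℂ) = ((n.factorial : ℕ) : ℂ) := by exact_mod_cast sL
    rw [h3, ← h2] at e
    push_cast at e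
    rw [hP, hKd]
    linear_combination e
  have hPf : Pfac Ig x = (((Dg - 1).factorial : ℕ) : ℂ) / P := by
    unfold Pfac; rw [hP]; push_cast; rfl
  have hkap : kap Ig (x Ig.b) (x Ig.c) k = ((B.factorial : ℕ) : ℂ) / Kd := by
    unfold kap; rw [hKd, hB]; push_cast; rfl
  rw [hPf, hkap]
  calc ((Lof Ig x k).multinomial : ℂ) = ((Lof Ig x k).multinomial : ℂ) * (P * Kd) / (P * Kd) := by
        field_simp
    _ = (n : ℂ) * ((((Dg + B - 1).choose B : ℕ) : ℂ) * ((B.factorial : ℕ) : ℂ) * (((Dg - 1).factorial : ℕ) : ℂ)) / (P * Kd) := by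
        rw [key]
    _ = (((Dg - 1).factorial : ℕ) : ℂ) / P * ((((Dg + B - 1).choose B : ℕ)) : ℂ) * (((B.factorial : ℕ) : ℂ) / Kd) * (n : ℂ) := by
        field_simp

/-- Fibre sums of the free substitution: `coeff_x (φ_M H) = Σ_{k ∈ KR x} coeff_{L_k} H` (for `x a = 0`). [folklore] -/
theorem coeff_phiT_frM (H : MvPolynomial σ ℂ) (x : σ →₀ ℕ) (hx : x Ig.a = 0) :
    coeff x (phiT (frM Ig) H) = ∑ k ∈ KR Ig x, coeff (Lof Ig x k) H := by
  classical
  rw [coeff_phiT]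
  rw [← Finset.sum_filter_add_sum_filter_not (KR Ig x) (fun k => Lof Ig x k ∈ H.support)]
  rw [Finset.sum_eq_zero (s := (KR Ig x).filter fun k => ¬ Lof Ig x k ∈ H.support)
    (fun k hk => notMem_support_iff.mp (Finset.mem_filter.mp hk).2), add_zero]
  apply Finset.sum_nbij' (fun L => L Ig.a) (fun k => Lof Ig x k)
  · intro L hL
    rw [Finset.mem_filter] at hL
    obtain ⟨-, hk, hLeq⟩ := eq_Lof_of_piT Ig L x hL.2
    rw [Finset.mem_filter, ← hLeq]
    exact ⟨hk, hL.1⟩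
  · intro k hk
    rw [Finset.mem_filter] at hk
    rw [Finset.mem_filter]
    exact ⟨hk.2, piT_Lof Ig x hx k hk.1⟩
  · intro L hL
    rw [Finset.mem_filter] at hL
    exact (eq_Lof_of_piT Ig L x hL.2).2.2.symm
  · intro k _
    exact Lof_a Ig x k
  · intro L hL
    rw [Finset.mem_filter] at hL
    obtain ⟨-, -, hLeq⟩ := eq_Lof_of_piT Ig L x hL.2
    rw [← hLeq]

/-! ## Part T4: the slice functions `F_{b₁,b₂}` (double slicing) and THE COEFFICIENT THEOREM for the free lift of the truncated
logarithm -/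

section Slice
variable {m : ℕ}

/-- The slice indicator `[ν_a = 0] [ν_b = 0] [ν_c = 0]`. [folklore] -/
def ind (ν : σ → ℕ) : ℂ := if ν Ig.a = 0 ∧ ν Ig.b = 0 ∧ ν Ig.c = 0 then 1 else 0

/-- The ADDITIVE letter-count form `λ(ν) = Σ_{j ∉ {a, b, c}} ν_j`. [folklore] -/
def lam (ν : σ → ℕ) : ℕ := ∑ j ∈ rest Ig, ν j

/-- The exponential factor over the untouched letters. [folklore] -/
def restProd (t : σ → ℂ) (ν : σ → ℕ) : ℂ := ∏ j ∈ rest Ig, t j ^ ν j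

/-- The admissibility guard `[q k ≤ b₁] [r k ≤ b₂] [p ∣ b₁ - q k] [p ∣ b₂ - r k]`. [folklore] -/
def gd (b₁ b₂ k : ℕ) : ℂ := if Adm Ig b₁ b₂ k then 1 else 0

/-- The `ν`-independent part of the `(j, k)` term:
`[admissible] · ± (-1)^{b₁ + b₂ + B_k} t_{ja}^k t_{jb}^{(b₁ - qk)/p} t_{jc}^{(b₂ - rk)/p} · κ_k`. [folklore] -/
def mainConst (c d : Fin m → σ → ℂ) (b₁ b₂ : ℕ) (j : Fin m ⊕ Fin m) (k : ℕ) : ℂ :=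
  gd Ig b₁ b₂ k * (sgn m j * (-1) ^ (b₁ + b₂ + Bk Ig b₁ b₂ k) * tab c d j Ig.a ^ k * tab c d j Ig.b ^ ((b₁ - Ig.q * k) / Ig.p) *
    tab c d j Ig.c ^ ((b₂ - Ig.r * k) / Ig.p) * kap Ig b₁ b₂ k)

/-- The `(j, k)` term of the slice function `F_{b₁,b₂}`: `mainConst · ∏_rest t_{je}^{ν_e} · C(λ(ν) + B_k - 1, B_k)`. [folklore] -/
def mainTerm (c d : Fin m → σ → ℂ) (b₁ b₂ : ℕ) (j : Fin m ⊕ Fin m) (k : ℕ) (ν : σ → ℕ) : ℂ :=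
  mainConst Ig c d b₁ b₂ j k *
    (restProd Ig (tab c d j) ν * (((lam Ig ν + (Bk Ig b₁ b₂ k - 1)).choose (Bk Ig b₁ b₂ k) : ℕ) : ℂ))

/-- The correction at the exceptional point `ν = 0` of the slice (the exponent `b₁ e_β + b₂ e_γ`). [folklore] -/
def corr (c d : Fin m → σ → ℂ) (b₁ b₂ : ℕ) (ν : σ → ℕ) : ℂ :=
  if (∀ j, ν j = 0) then
    ∑ j : Fin m ⊕ Fin m, ∑ k : Fin (b₁ + b₂ + 1), mainConst Ig c d b₁ b₂ j k / ((Bk Ig b₁ b₂ k : ℕ) : ℂ)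
  else 0

/-- **The slice function** `F_{b₁,b₂}` of the free lift of the truncated logarithm. [folklore] -/
def Fsl (c d : Fin m → σ → ℂ) (b₁ b₂ : ℕ) (ν : σ → ℕ) : ℂ :=
  ind Ig ν * (∑ j : Fin m ⊕ Fin m, ∑ k : Fin (b₁ + b₂ + 1), mainTerm Ig c d b₁ b₂ j k ν) + corr Ig c d b₁ b₂ ν

/-- `lam_xhat` — technical lemma of the R7b dilated free-lift toolkit (val-idea-8 g3). [folklore] -/
theorem lam_xhat (x : σ →₀ ℕ) : lam Ig ⇑(xhat Ig x) = deg (xhat Ig x) := by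
  rw [deg_xhat]; unfold lam
  exact Finset.sum_congr rfl fun j hj => xhat_rest Ig x j hj

/-- `restProd_xhat` — technical lemma of the R7b dilated free-lift toolkit (val-idea-8 g3). [folklore] -/
theorem restProd_xhat (t : σ → ℂ) (x : σ →₀ ℕ) : restProd Ig t ⇑(xhat Ig x) = ∏ j ∈ rest Ig, t j ^ x j := by
  unfold restProd
  exact Finset.prod_congr rfl fun j hj => by rw [xhat_rest Ig x j hj]

/-- `mom_Lof` — technical lemma of the R7b dilated free-lift toolkit (val-idea-8 g3). [folklore] -/
theorem mom_Lof (t : σ → ℂ) (x : σ →₀ ℕ) (k : ℕ) :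
    mom t (Lof Ig x k) =
      t Ig.a ^ k * t Ig.b ^ ((x Ig.b - Ig.q * k) / Ig.p) * t Ig.c ^ ((x Ig.c - Ig.r * k) / Ig.p) * restProd Ig t ⇑(xhat Ig x) := by
  unfold mom
  rw [prod_three_split Ig, Lof_a, Lof_b, Lof_c, restProd_xhat]
  have hr : ∏ j ∈ rest Ig, t j ^ (Lof Ig x k) j = ∏ j ∈ rest Ig, t j ^ x j := by
    refine Finset.prod_congr rfl fun j hj => ?_
    rw [mem_rest] at hj
    rw [Lof_other Ig x k j hj.1 hj.2.1 hj.2.2]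
  rw [hr]; ring

/-- `ind_xhat` — technical lemma of the R7b dilated free-lift toolkit (val-idea-8 g3). [folklore] -/
theorem ind_xhat (x : σ →₀ ℕ) : ind Ig ⇑(xhat Ig x) = 1 := by
  unfold ind; rw [if_pos ⟨xhat_a Ig x, xhat_b Ig x, xhat_c Ig x⟩]

/-- `corr_xhat` — technical lemma of the R7b dilated free-lift toolkit (val-idea-8 g3). [folklore] -/
theorem corr_xhat (c d : Fin m → σ → ℂ) (b₁ b₂ : ℕ) (x : σ →₀ ℕ) (h1 : 1 ≤ deg (xhat Ig x)) :
    corr Ig c d b₁ b₂ ⇑(xhat Ig x) = 0 := by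
  unfold corr
  rw [if_neg]
  intro h
  have : xhat Ig x = 0 := by ext j; exact h j
  rw [this] at h1
  simp [deg] at h1


/-- `gd_pos` — technical lemma of the R7b dilated free-lift toolkit (val-idea-8 g3). [folklore] -/
theorem gd_pos {b₁ b₂ k : ℕ} (h : Adm Ig b₁ b₂ k) : gd Ig b₁ b₂ k = 1 := by
  unfold gd; rw [if_pos h]

/-- `gd_neg` — technical lemma of the R7b dilated free-lift toolkit (val-idea-8 g3). [folklore] -/
theorem gd_neg {b₁ b₂ k : ℕ} (h : ¬ Adm Ig b₁ b₂ k) : gd Ig b₁ b₂ k = 0 := by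
  unfold gd; rw [if_neg h]

/-- `mainConst_eq_zero` — technical lemma of the R7b dilated free-lift toolkit (val-idea-8 g3). [folklore] -/
theorem mainConst_eq_zero (c d : Fin m → σ → ℂ) {b₁ b₂ k : ℕ} (h : ¬ Adm Ig b₁ b₂ k) (j : Fin m ⊕ Fin m) :
    mainConst Ig c d b₁ b₂ j k = 0 := by
  unfold mainConst; rw [gd_neg Ig h, zero_mul]

/-- The signed atom sum of the constants: `Σ_j mainConst_{jk} = [adm] (-1)^{(q+r+1)k} κ_k (Σ_j mom c_j L_k − Σ_j mom d_j L_k) /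
restProd`-free version at a reduced point. [folklore] -/
theorem sum_mainTerm_xhat (c d : Fin m → σ → ℂ) (x : σ →₀ ℕ) (h1 : 1 ≤ deg (xhat Ig x)) (k : ℕ) (hk : k ∈ KR Ig x) :
    ∑ j, mainTerm Ig c d (x Ig.b) (x Ig.c) j k ⇑(xhat Ig x) =
      (-1 : ℂ) ^ (x Ig.b + x Ig.c + Bk Ig (x Ig.b) (x Ig.c) k) *
        (((deg (xhat Ig x) + Bk Ig (x Ig.b) (x Ig.c) k - 1).choose (Bk Ig (x Ig.b) (x Ig.c) k) : ℕ) : ℂ) *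
          kap Ig (x Ig.b) (x Ig.c) k * (∑ j, mom (c j) (Lof Ig x k) - ∑ j, mom (d j) (Lof Ig x k)) := by
  have hk' := (mem_KR Ig x k).1 hk
  rw [Fintype.sum_sum_type]
  simp only [mainTerm, mainConst, gd_pos Ig hk', tab, sgn, Sum.elim_inl, Sum.elim_inr, lam_xhat,
    R7a.choose_bridge _ _ h1, mom_Lof Ig _ x k]
  rw [mul_sub, Finset.mul_sum, Finset.mul_sum, sub_eq_add_neg, ← Finset.sum_neg_distrib]
  congr 1
  · exact Finset.sum_congr rfl fun j _ => by ring
  · exact Finset.sum_congr rfl fun j _ => by ring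

/-- `sum_mainTerm_xhat_zero` — technical lemma of the R7b dilated free-lift toolkit (val-idea-8 g3). [folklore] -/
theorem sum_mainTerm_xhat_zero (c d : Fin m → σ → ℂ) (x : σ →₀ ℕ) (k : ℕ) (hk : ¬ Adm Ig (x Ig.b) (x Ig.c) k) :
    ∑ j, mainTerm Ig c d (x Ig.b) (x Ig.c) j k ⇑(xhat Ig x) = 0 := by
  refine Finset.sum_eq_zero fun j _ => ?_
  unfold mainTerm; rw [mainConst_eq_zero Ig c d hk j, zero_mul]

/-- The slice function at a reduced point is the fibre sum. [folklore] -/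
theorem Fsl_xhat_eq (c d : Fin m → σ → ℂ) (x : σ →₀ ℕ) (h1 : 1 ≤ deg (xhat Ig x)) :
    Fsl Ig c d (x Ig.b) (x Ig.c) ⇑(xhat Ig x) = ∑ k ∈ KR Ig x, (-1 : ℂ) ^ (x Ig.b + x Ig.c + Bk Ig (x Ig.b) (x Ig.c) k) *
        (((deg (xhat Ig x) + Bk Ig (x Ig.b) (x Ig.c) k - 1).choose (Bk Ig (x Ig.b) (x Ig.c) k) : ℕ) : ℂ) *
          kap Ig (x Ig.b) (x Ig.c) k * (∑ j, mom (c j) (Lof Ig x k) - ∑ j, mom (d j) (Lof Ig x k)) := by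
  unfold Fsl
  rw [ind_xhat, corr_xhat Ig c d _ _ x h1, one_mul, add_zero, Finset.sum_comm]
  rw [Fin.sum_univ_eq_sum_range (fun k => ∑ j, mainTerm Ig c d (x Ig.b) (x Ig.c) j k ⇑(xhat Ig x)) (x Ig.b + x Ig.c + 1)]
  unfold KR
  rw [Finset.sum_filter]
  refine Finset.sum_congr rfl fun k _ => ?_
  by_cases hk : Adm Ig (x Ig.b) (x Ig.c) k
  · rw [if_pos hk]
    exact sum_mainTerm_xhat Ig c d x h1 k ((mem_KR Ig x k).2 hk)
  · rw [if_neg hk]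
    exact sum_mainTerm_xhat_zero Ig c d x k hk

/-- **THE COEFFICIENT THEOREM** (double slicing). For `x` with `x_a = 0`, `R = deg x̂ ≥ 1` and `deg x ≤ R_t`:
`coeff_x φ_frM(Λ_{R_t}) = (-1)^{deg x + 1} · Pfac(x) · F_{x_b, x_c}(x̂)`. [folklore] -/
theorem coeff_free_logTrunc (c d : Fin m → σ → ℂ) (R : ℕ) (x : σ →₀ ℕ) (hx : x Ig.a = 0)
    (h1 : 1 ≤ deg (xhat Ig x)) (hR : deg x ≤ R) :
    coeff x (phiT (frM Ig) (logTrunc c d R)) =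
      (-1 : ℂ) ^ (deg x + 1) * Pfac Ig x * Fsl Ig c d (x Ig.b) (x Ig.c) ⇑(xhat Ig x) := by
  classical
  rw [coeff_phiT_frM Ig _ x hx]
  have hdx : deg x = deg (xhat Ig x) + (x Ig.b + x Ig.c) := by rw [deg_eq_deg_xhat_add Ig x, hx, zero_add]
  have step2 : ∀ k ∈ KR Ig x, coeff (Lof Ig x k) (logTrunc c d R) =
      (-1 : ℂ) ^ (deg x + 1) * Pfac Ig x * ((-1 : ℂ) ^ (x Ig.b + x Ig.c + Bk Ig (x Ig.b) (x Ig.c) k) *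
        (((deg (xhat Ig x) + Bk Ig (x Ig.b) (x Ig.c) k - 1).choose (Bk Ig (x Ig.b) (x Ig.c) k) : ℕ) : ℂ) *
          kap Ig (x Ig.b) (x Ig.c) k * (∑ j, mom (c j) (Lof Ig x k) - ∑ j, mom (d j) (Lof Ig x k))) := by
    intro k hk
    have hk' := (mem_KR Ig x k).1 hk
    have hdeg := deg_Lof_eq Ig x k hk
    have hBle := Bk_le Ig hk'
    have hdeg1 : 1 ≤ deg (Lof Ig x k) := by omega
    have hdegR : deg (Lof Ig x k) ≤ R := by omega
    rw [coeff_logTrunc c d R _ hdeg1 hdegR, multinomial_Lof_eq Ig x k hk h1]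
    have hsign : (-1 : ℂ) ^ (deg (Lof Ig x k) + 1) =
        (-1) ^ (deg x + 1) * (-1) ^ (x Ig.b + x Ig.c + Bk Ig (x Ig.b) (x Ig.c) k) := by
      have e : deg x + 1 + (x Ig.b + x Ig.c + Bk Ig (x Ig.b) (x Ig.c) k) = (deg (Lof Ig x k) + 1) + 2 * (x Ig.b + x Ig.c) := by
        omega
      rw [← pow_add, e, pow_add (-1 : ℂ) (deg (Lof Ig x k) + 1), pow_mul]
      norm_num
    have hn0 : ((deg (Lof Ig x k) : ℕ) : ℂ) ≠ 0 := Nat.cast_ne_zero.mpr (by omega)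
    rw [hsign]
    field_simp
  rw [Finset.sum_congr rfl step2, ← Finset.mul_sum, Fsl_xhat_eq Ig c d x h1]

/-! ### The exceptional point of a slice (`R = 0`, i.e. `x = b₁ e_β + b₂ e_γ`) -/


end Slice

end R7b
end Summit.ValiantsHypothesis.ValiantsHypothesis.Theorems.NewtonUnitEquations.TwoProducts.PermutationType

end
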